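import Mathlib

/-!
# Stub `stub_perpBasis` (crux `OrbitDimensionBound`, line `Sketch`)

For an integer family `Λ : Fin r → ι → ℤ` there is an integer family `b` orthogonal to every
`Λ i` with the double-annihilator property: an integer vector orthogonal to every `b j` has a
non-zero integer multiple in the `ℤ`-span of the `Λ i`.  Proof: finite-dimensional duality over
`ℚ` (`Subspace.dualAnnihilator_dualCoannihilator_eq`) for the rational span of the `Λ i`, a basis
of its dual annihilator turned into rational coefficient vectors, and clearing denominators
(`IsLocalization.exist_integer_multiples_of_finite`).
-/

set_option linter.dupNamespace false

namespace Summit.ValiantsHypothesis.ValiantsHypothesis.Theorems.FreeSubtorusOrbitDimensionBound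

open Finset

/-- Clearing denominators of a finite family of rationals: a non-zero integer `D` and integers
`g a` with `g a = D * f a`. -/
private theorem exists_int_mul_eq {α : Type} [Finite α] (f : α → ℚ) :
    ∃ (D : ℤ) (g : α → ℤ), D ≠ 0 ∧ ∀ a, (g a : ℚ) = D * f a := by
  obtain ⟨⟨D, hD⟩, h⟩ := IsLocalization.exist_integer_multiples_of_finite (nonZeroDivisors ℤ) f
  have h' : ∀ a, ∃ z : ℤ, (z : ℚ) = D * f a := fun a => by
    obtain ⟨z, hz⟩ := h a
    exact ⟨z, by simpa [zsmul_eq_mul] using hz⟩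
  choose g hg using h'
  exact ⟨D, g, nonZeroDivisors.ne_zero hD, hg⟩

/-- **Stub `stub_perpBasis`.**  For an integer family `Λ` there is an integer family `b`
orthogonal to every `Λ i` such that an integer vector orthogonal to every `b j` has a non-zero
multiple in `ℤΛ` (the `b j` span the rational orthogonal complement of `ℤΛ`; double annihilator
over `ℚ` plus clearing denominators). [folklore] -/
theorem stub_perpBasis {ι : Type} [Fintype ι] [DecidableEq ι] (r : ℕ) (Λ : Fin r → ι → ℤ) :
    ∃ (s : ℕ) (b : Fin s → ι → ℤ),
      (∀ j i, ∑ k, b j k * Λ i k = 0) ∧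
      ∀ x : ι → ℤ, (∀ j, ∑ k, b j k * x k = 0) →
        ∃ (c : ℤ) (z : Fin r → ℤ), c ≠ 0 ∧ c • x = ∑ i, z i • Λ i := by
  classical
  -- the rational span `W` of the `Λ i` and its dual annihilator `A`
  let Λq : Fin r → ι → ℚ := fun i k => (Λ i k : ℚ)
  let W : Submodule ℚ (ι → ℚ) := Submodule.span ℚ (Set.range Λq)
  let A : Submodule ℚ (Module.Dual ℚ (ι → ℚ)) := W.dualAnnihilator
  let β := Module.finBasis ℚ A
  -- rational coefficient vectors of the basis functionals
  let v : Fin (Module.finrank ℚ A) × ι → ℚ :=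
    fun p => (β p.1 : Module.Dual ℚ (ι → ℚ)) (fun j => if p.2 = j then 1 else 0)
  -- every functional is the dot product with its coefficient vector
  have hφ : ∀ (φ : Module.Dual ℚ (ι → ℚ)) (y : ι → ℚ),
      φ y = ∑ k, y k * φ (fun j => if k = j then 1 else 0) := fun φ y => by
    rw [LinearMap.pi_apply_eq_sum_univ φ y]
    simp only [smul_eq_mul]
  -- clear denominators (one common denominator for all coefficient vectors)
  obtain ⟨D, bq, hD, hbq⟩ := exists_int_mul_eq v
  refine ⟨Module.finrank ℚ A, fun j k => bq (j, k), fun j i => ?_, fun x hx => ?_⟩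
  · -- orthogonality to the `Λ i`: `β j` annihilates `W ∋ Λq i`
    have hmem : Λq i ∈ W := Submodule.subset_span ⟨i, rfl⟩
    have hann : (β j : Module.Dual ℚ (ι → ℚ)) (Λq i) = 0 :=
      (Submodule.mem_dualAnnihilator _).1 (β j).2 _ hmem
    rw [hφ _ (Λq i)] at hann
    apply Int.cast_injective (α := ℚ)
    push_cast
    simp_rw [hbq]
    calc ∑ k, (D : ℚ) * v (j, k) * (Λ i k : ℚ)
        = D * ∑ k, Λq i k * (β j : Module.Dual ℚ (ι → ℚ)) (fun j' => if k = j' then 1 else 0) := by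
          rw [Finset.mul_sum]
          refine Finset.sum_congr rfl fun k _ => ?_
          simp only [v, Λq]
          ring
      _ = 0 := by rw [hann, mul_zero]
  · -- double annihilator: `x` is killed by every `β j`, hence by `A`, hence lies in `W`
    let xq : ι → ℚ := fun k => (x k : ℚ)
    have hkill : ∀ j, (β j : Module.Dual ℚ (ι → ℚ)) xq = 0 := fun j => by
      have h0 : ((∑ k, bq (j, k) * x k : ℤ) : ℚ) = 0 := by rw [hx j, Int.cast_zero]
      push_cast at h0
      simp_rw [hbq] at h0
      have h1 : (D : ℚ) * (β j : Module.Dual ℚ (ι → ℚ)) xq = 0 := by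
        refine Eq.trans ?_ h0
        rw [hφ _ xq, Finset.mul_sum]
        refine Finset.sum_congr rfl fun k _ => ?_
        simp only [v, xq]
        ring
      exact (mul_eq_zero.1 h1).resolve_left (Int.cast_ne_zero.2 hD)
    have hxA : xq ∈ A.dualCoannihilator := by
      rw [Submodule.mem_dualCoannihilator]
      intro φ hφA
      have key : (Module.Dual.eval ℚ (ι → ℚ) xq).comp A.subtype = 0 :=
        β.ext fun j => by simpa using hkill j
      simpa using LinearMap.congr_fun key ⟨φ, hφA⟩
    have hxW : xq ∈ W := by
      rw [← Subspace.dualAnnihilator_dualCoannihilator_eq (W := W)]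
      exact hxA
    obtain ⟨q, hq⟩ := (Submodule.mem_span_range_iff_exists_fun ℚ).1 hxW
    obtain ⟨c, z, hc, hz⟩ := exists_int_mul_eq q
    refine ⟨c, z, hc, ?_⟩
    funext k
    apply Int.cast_injective (α := ℚ)
    have hxk : (x k : ℚ) = ∑ i, q i * (Λ i k : ℚ) := by
      have := congr_fun hq k
      simpa [Finset.sum_apply, Pi.smul_apply, smul_eq_mul, xq, Λq] using this.symm
    simp only [Pi.smul_apply, Finset.sum_apply, smul_eq_mul]
    push_cast
    rw [hxk, Finset.mul_sum]
    refine Finset.sum_congr rfl fun i _ => ?_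
    rw [hz i]
    ring

end Summit.ValiantsHypothesis.ValiantsHypothesis.Theorems.FreeSubtorusOrbitDimensionBound
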